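import Literature.ModelTheory.ExponentialFields.Wilkie1996JacobianColumns
import Literature.ModelTheory.ExponentialFields.DefinableClosureOrderedField
import Literature.ModelTheory.ExponentialFields.ETheory
import HarnessLib

/-!
# Wilkie 1996, §11 / den Besten 2016, Lemma 7.2.4, Claim (second half): the coordinates of a non-singular zero of a system from `Mˢₙ` lie in `Dcl(k ∪ B)`, `|B| ≤ |s|`

Topic `Literature/ModelTheory/ExponentialFields`.  In the proof of the boundedness leaf
`Wilkie1996_expPolynomialPoints_bounded` (A. J. Wilkie, J. Amer. Math. Soc. 9 (1996), §§9–11;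
M. den Besten, MSc thesis, Utrecht 2016, §7.2) the valuation inequality for `T_e` is applied to
`k* = Dcl_{k'}(ᾱ, exp ᾱ_s)`, through the dimension count

> **Claim** (den Besten, proof of Lemma 7.2.4). `dim_{k'}(k*) ≤ m`: "*we will show that
> `{αᵢ | 1 ≤ i ≤ n + m}` contains an `m`-element subset which generates `k*` over `k'`* …
> *So, by Proposition 6.2.7 (iii) …, there are only finitely many such points.  Since the `hᵢ`
> are `k'`-definable over `α_{n+1}, …, α_{n+m}`, this implies that
> `α₁, …, αₙ ∈ Dcl_{k'}({αᵢ | n + 1 ≤ i ≤ n + m})` and hence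
> `k* = Dcl_{k'}({αᵢ | 1 ≤ i ≤ n + m}) = Dcl_{k'}({αᵢ | n + 1 ≤ i ≤ n + m})`, proving our claim.*"

`Wilkie1996JacobianColumns.lean` proves the first half ("the Claim minus the words *definable
closure*", `RealExpModel.IsMsZero.exists_selection`: a selection `σ` of `n` generators among
`x₁, …, xₙ, yⱼ (j ∈ s)` whose values form a non-singular zero of the specialised square system
`h̄ ∈ M^∅ₙ` over `K`, one of finitely many).  **This file proves the second half** — the reading
in the definable closure — for *any* language `L'` on `K` expanding `(+, ·, -, 0, 1, ≤)`
compatibly in which the graph of `e(x) = exp((1 + x²)⁻¹)` is `∅`-definable, and instantiates it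
to the language `L_e` of `T_e` (`ETheory.lean`), using the definable closure `definableClosure`
of `DefinableClosure.lean`:

* `RealExpModel.DclClaim.card_unselected` — the unselected generators among
  `x₁, …, xₙ, yⱼ (j ∈ s)` number exactly `|s|` (the selected `y`-columns lie in `s`);
* `RealExpModel.DclClaim.definableFun_msEval_specialise`,
  `RealExpModel.DclClaim.definable_setOf_isMsZero_specialise` — "*the `hᵢ` are `k'`-definable
  over `α_{n+1}, …, α_{n+m}`*": the set of non-singular zeros of `h̄` is `L'`-definable over
  `f(k)`, the values of the unselected generators and the auxiliary values `(1 + αⱼ²)⁻¹`,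
  `e(αⱼ)` (themselves definable over `αⱼ`), by induction over the allowed generators of `Mˢₙ`
  (`Mˢₙ` is closed under the derivations `∂ˣⱼ`, `∂/∂yⱼ`: `msSupported_msDX`,
  `msSupported_pderiv`) with a small kit of definable functions in `L'` (`definableFun_add`,
  `_mul`, `_neg`, `_sum`, `_prod`, `_det`, `_inv_one_add_sq`, `_e`);
* `RealExpModel.DclClaim.apply_mem_definableClosure_of_finite` — the coordinates of the points
  of a finite `A`-definable subset of `Kᴺ` lie in `dcl(A)` (`subset_definableClosure_of_finite`
  of `OMinimalPregeometry.lean` on each coordinate projection);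
* `RealExpModel.DclClaim.sum_intCast_mul_mem_definableClosure` — `dcl(A)` is a subring
  (`add_mem_definableClosure`, …), so it contains the `z = Σ νᵢ αᵢ` of 9.3;
* **`RealExpModel.IsMsZero.exists_subset_definableClosure`** (the Claim: `B ⊆ {αⱼ} ∪ {exp αⱼ :
  j ∈ s}`, `|B| ≤ |s|`, all `αⱼ` and `exp αⱼ (j ∈ s)` in `Dcl_{L'}(f(k) ∪ B)`),
  `RealExpModel.IsMsZero.exists_definableClosure_eq` (`k* = Dcl_{L'}(f(k) ∪ B)`),
  `RealExpModel.IsMsZero.exists_kstar` (with the `Σ νᵢ αᵢ`), and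
  **`RealExpModel.IsMsZero.exists_kstar_orderedERing`** (the case `L' = L_e`,
  `definable_eGraph_orderedERing`).

What remains between this and the hypothesis `hval` of
`Wilkie1996_expPolynomialPoints_bounded_of_valuationInequality` (`Wilkie1996ValuationStep.lean`)
is the valuation inequality `valdim_{k'} k* ≤ dim_{k'} k* (≤ |B| ≤ |s|)` for `T_e`
(Wilkie, Theorems 10.3–10.4; den Besten, Theorems 7.1.21–7.1.23), which needs the model
completeness, o-minimality and polynomial bounds of `T_e` ((V1)–(V3) of `Wilkie1996.lean`).
Nothing here is a named fact; no definition is introduced.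

## References

* M. den Besten, *Wilkie's Theorem and the Uniform Real Schanuel Conjecture*, MSc thesis, Utrecht
  (2016): Lemma 7.2.4, Claim, and the proof of (36), pp. 95–98; Lemma 7.1.6. [DenBesten2016]
* A. J. Wilkie, *Model completeness results for expansions of the ordered field of real numbers by
  restricted Pfaffian functions and the exponential function*, J. Amer. Math. Soc. 9 (1996),
  1051–1094: §11 (proof of 9.3 from Theorems 10.3, 10.4, Lemma 10.5, Lemma 11.2). [WilkieJAMS1996]
* D. Marker, *Model Theory: An Introduction*, GTM 217 (2002), Exercise 1.4.10 (definable
  closure). [Marker2002]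
-/

noncomputable section

open FirstOrder FirstOrder.Language FirstOrder.Language.Structure
open MvPolynomial

namespace Literature.ModelTheory.ExponentialFields

namespace RealExpModel

variable {k K : Language.Theory.ModelType.{0, 0, 0} realExpTheory}

namespace DclClaim

/-! ### Supports of derivatives: `Mˢₙ` is closed under `∂ˣⱼ` and `∂/∂yⱼ` -/

section Support

variable {R : Type*} [CommRing R] {σ : Type*}

/-- A derivation of a polynomial ring which maps the generators from a set `V` of variables into
the subalgebra of polynomials supported on `V` maps that whole subalgebra into itself. [folklore] -/
theorem mkDerivation_mem_supported (ξ : σ → MvPolynomial σ R) {V : Set σ}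
    (hξ : ∀ w ∈ V, ξ w ∈ supported R V) {Q : MvPolynomial σ R} (hQ : Q ∈ supported R V) :
    mkDerivation R ξ Q ∈ supported R V := by
  rw [supported_eq_adjoin_X] at hQ hξ ⊢
  induction hQ using Algebra.adjoin_induction with
  | mem x hx =>
    obtain ⟨w, hw, rfl⟩ := hx
    rw [mkDerivation_X]
    exact hξ w hw
  | algebraMap r =>
    rw [Derivation.map_algebraMap]
    exact Subalgebra.zero_mem _
  | add x y hx hy hx' hy' =>
    rw [(mkDerivation R ξ).map_add]
    exact Subalgebra.add_mem _ hx' hy'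
  | mul x y hx hy hx' hy' =>
    rw [Derivation.leibniz, smul_eq_mul, smul_eq_mul]
    exact Subalgebra.add_mem _ (Subalgebra.mul_mem _ hx hy') (Subalgebra.mul_mem _ hy hx')

end Support

section MsSupport

variable {n : ℕ} (s : Finset (Fin n))

/-- The set of generators allowed in `Mˢₙ`. [folklore] -/
theorem msSupported_iff_mem_supported {m : ℕ} (s' : Finset (Fin m))
    {k' : Language.Theory.ModelType.{0, 0, 0} realExpTheory} (Q : MvPolynomial (MsVar m) k') :
    MsSupported s' Q ↔ Q ∈ supported k' {w : MsVar m | w.1 = MsKind.y → w.2 ∈ s'} := by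
  rw [mem_supported]
  exact ⟨fun h w hw => h w hw, fun h w hw => h hw⟩

/-- The `yⱼ`-truncated derivative of an element of `Mˢₙ` lies in `Mˢₙ`. [folklore] -/
theorem msSupported_msDX {Q : MvPolynomial (MsVar n) k} (hQ : MsSupported s Q) (j : Fin n) :
    MsSupported s (msDX k j Q) := by
  rw [msSupported_iff_mem_supported] at hQ ⊢
  refine mkDerivation_mem_supported _ (fun w _ => ?_) hQ
  have hx : ∀ i, (X (MsKind.x, i) : MvPolynomial (MsVar n) k) ∈
      supported k {w : MsVar n | w.1 = MsKind.y → w.2 ∈ s} :=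
    fun i => (X_mem_supported.2 (by simp))
  have hu : ∀ i, (X (MsKind.u, i) : MvPolynomial (MsVar n) k) ∈
      supported k {w : MsVar n | w.1 = MsKind.y → w.2 ∈ s} :=
    fun i => (X_mem_supported.2 (by simp))
  have hv : ∀ i, (X (MsKind.v, i) : MvPolynomial (MsVar n) k) ∈
      supported k {w : MsVar n | w.1 = MsKind.y → w.2 ∈ s} :=
    fun i => (X_mem_supported.2 (by simp))
  rcases w with ⟨κ, i⟩
  cases κ
  · show msDir j (MsKind.x, i) ∈ _
    simp only [msDir]
    split_ifs
    · exact Subalgebra.one_mem _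
    · exact Subalgebra.zero_mem _
  · show msDir j (MsKind.u, i) ∈ _
    simp only [msDir]
    split_ifs
    · exact Subalgebra.mul_mem _ (Subalgebra.mul_mem _ (Subalgebra.algebraMap_mem _ _) (hx j))
        (Subalgebra.pow_mem _ (hu j) 2)
    · exact Subalgebra.zero_mem _
  · show msDir j (MsKind.v, i) ∈ _
    simp only [msDir]
    split_ifs
    · exact Subalgebra.mul_mem _ (Subalgebra.mul_mem _ (Subalgebra.mul_mem _
        (Subalgebra.algebraMap_mem _ _) (hx j)) (Subalgebra.pow_mem _ (hu j) 2)) (hv j)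
    · exact Subalgebra.zero_mem _
  · exact Subalgebra.zero_mem _

/-- A partial derivative of an element of `Mˢₙ` lies in `Mˢₙ`. [folklore] -/
theorem msSupported_pderiv {Q : MvPolynomial (MsVar n) k} (hQ : MsSupported s Q) (w₀ : MsVar n) :
    MsSupported s (pderiv w₀ Q) := by
  classical
  rw [msSupported_iff_mem_supported] at hQ ⊢
  rw [pderiv_def]
  refine mkDerivation_mem_supported _ (fun w _ => ?_) hQ
  by_cases h : w₀ = w
  · subst h; simp only [Pi.single_eq_same]; exact Subalgebra.one_mem _
  · rw [Pi.single_eq_of_ne' h]; exact Subalgebra.zero_mem _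

/-- The derivation attached to a column of the full Jacobian (`RealExpModel.colDeriv`: `∂ˣⱼ` or
`∂/∂yⱼ`) maps `Mˢₙ` into itself. [folklore] -/
theorem msSupported_colDeriv {Q : MvPolynomial (MsVar n) k} (hQ : MsSupported s Q) (c : Fin n ⊕ Fin n) :
    MsSupported s (colDeriv k c Q) := by
  cases c with
  | inl j => exact msSupported_msDX s hQ j
  | inr j => exact msSupported_pderiv s hQ _

end MsSupport

/-! ### Counting the unselected generators -/

section Counting

variable {n : ℕ} {s : Finset (Fin n)} {σ : Fin n → Fin n ⊕ Fin n}

/-- **The unselected generators among `x₁, …, xₙ, yⱼ (j ∈ s)` number exactly `|s|`**: the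
selection `σ` picks `n` distinct columns of the full Jacobian, all among the `n + |s|` columns
`inl j` (`j ≤ n`) and `inr j` (`j ∈ s`) (the other `y`-columns vanish), so their complement
within these has `|s|` elements. [cite: DenBesten2016, proof of Lemma 7.2.4 (Claim)] -/
theorem card_unselected (hσ : Function.Injective σ) (hσs : ∀ j i, σ j = Sum.inr i → i ∈ s) :
    ((Finset.univ.image σ)ᶜ \ sᶜ.image Sum.inr).card = s.card := by
  classical
  have hC : ((Finset.univ.image σ)ᶜ : Finset (Fin n ⊕ Fin n)).card = n := by
    rw [Finset.card_compl, Finset.card_image_of_injective _ hσ, Finset.card_univ,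
      Fintype.card_sum, Fintype.card_fin]
    omega
  have hF : (sᶜ.image Sum.inr : Finset (Fin n ⊕ Fin n)).card = n - s.card := by
    rw [Finset.card_image_of_injective _ Sum.inr_injective, Finset.card_compl, Fintype.card_fin]
  have hsub : (sᶜ.image Sum.inr : Finset (Fin n ⊕ Fin n)) ⊆ (Finset.univ.image σ)ᶜ := by
    intro c hc
    rw [Finset.mem_image] at hc
    obtain ⟨i, hi, rfl⟩ := hc
    rw [Finset.mem_compl] at hi ⊢
    intro h
    rw [Finset.mem_image] at h
    obtain ⟨j, _, hj⟩ := h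
    exact hi (hσs j i hj)
  have hs : s.card ≤ n := by simpa using s.card_le_univ
  rw [Finset.card_sdiff, Finset.inter_eq_left.2 hsub, hC, hF]
  omega

/-- Membership in the set of unselected generators. [folklore] -/
theorem mem_unselected_iff {c : Fin n ⊕ Fin n} :
    c ∈ (Finset.univ.image σ)ᶜ \ sᶜ.image Sum.inr ↔
      (∀ j₁, σ j₁ ≠ c) ∧ ∀ i, c = Sum.inr i → i ∈ s := by
  classical
  simp only [Finset.mem_sdiff, Finset.mem_compl, Finset.mem_image, Finset.mem_univ, true_and,
    not_exists, not_and]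
  constructor
  · rintro ⟨h1, h2⟩
    refine ⟨h1, fun i hi => ?_⟩
    by_contra his
    exact h2 i his hi.symm
  · rintro ⟨h1, h2⟩
    exact ⟨h1, fun i his hi => his (h2 i hi.symm)⟩

end Counting

/-! ### Definability in an expansion `L'` of the ordered field `K` in which `e` is definable -/

section Definability

variable {L' : FirstOrder.Language.{0, 0}} [L'.Structure K] (φ : Language.orderedRing →ᴸ L') [φ.IsExpansionOn K]
variable {A : Set K} {ι : Type*}

include φ

/-- Transfer of definable functions from the language of ordered rings to the expansion `L'`.
[folklore] -/
theorem definableFun_of_orderedRing {F : (ι → K) → K}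
    (h : A.DefinableFun Language.orderedRing F) : A.DefinableFun L' F := by
  unfold Set.DefinableFun at h ⊢
  exact h.map_expansion φ

/-- The constant function `0` is `∅`-definable. [folklore] -/
theorem definableFun_zero : A.DefinableFun L' (fun _ : ι → K => (0 : K)) := by
  refine definableFun_of_orderedRing φ (Set.DefinableFun.of_empty ?_)
  have h := (0 : Language.orderedRing.Term ι).definableFun_realize (M := K)
  simp only [Language.orderedRing.realize_zero] at h
  exact h

/-- The constant function `1` is `∅`-definable. [folklore] -/
theorem definableFun_one : A.DefinableFun L' (fun _ : ι → K => (1 : K)) := by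
  refine definableFun_of_orderedRing φ (Set.DefinableFun.of_empty ?_)
  have h := (1 : Language.orderedRing.Term ι).definableFun_realize (M := K)
  simp only [Language.orderedRing.realize_one] at h
  exact h

/-- Sums of definable functions are definable. [folklore] -/
theorem definableFun_add {p q : (ι → K) → K} (hp : A.DefinableFun L' p) (hq : A.DefinableFun L' q) :
    A.DefinableFun L' (fun v => p v + q v) := by
  have h1 : (∅ : Set K).DefinableFun Language.orderedRing (fun w : Fin 2 → K => w 0 + w 1) := by
    have h := (Term.var (0 : Fin 2) + Term.var 1 :
      Language.orderedRing.Term (Fin 2)).definableFun_realize (M := K)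
    simp only [Language.orderedRing.realize_add, Term.realize_var] at h
    exact h
  have h2 : A.DefinableFun L' (fun w : Fin 2 → K => w 0 + w 1) :=
    definableFun_of_orderedRing φ h1.of_empty
  have hg : A.DefinableMap L' (fun v : ι → K => ![p v, q v]) := by
    intro i
    fin_cases i
    · simpa using hp
    · simpa using hq
  simpa using h2.comp hg

/-- Products of definable functions are definable. [folklore] -/
theorem definableFun_mul {p q : (ι → K) → K} (hp : A.DefinableFun L' p) (hq : A.DefinableFun L' q) :
    A.DefinableFun L' (fun v => p v * q v) := by
  have h1 : (∅ : Set K).DefinableFun Language.orderedRing (fun w : Fin 2 → K => w 0 * w 1) := by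
    have h := (Term.var (0 : Fin 2) * Term.var 1 :
      Language.orderedRing.Term (Fin 2)).definableFun_realize (M := K)
    simp only [Language.orderedRing.realize_mul, Term.realize_var] at h
    exact h
  have h2 : A.DefinableFun L' (fun w : Fin 2 → K => w 0 * w 1) :=
    definableFun_of_orderedRing φ h1.of_empty
  have hg : A.DefinableMap L' (fun v : ι → K => ![p v, q v]) := by
    intro i
    fin_cases i
    · simpa using hp
    · simpa using hq
  simpa using h2.comp hg

/-- Negatives of definable functions are definable. [folklore] -/
theorem definableFun_neg {p : (ι → K) → K} (hp : A.DefinableFun L' p) :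
    A.DefinableFun L' (fun v => -p v) := by
  have h1 : (∅ : Set K).DefinableFun Language.orderedRing (fun w : Fin 1 → K => -w 0) := by
    have h := (-Term.var (0 : Fin 1) :
      Language.orderedRing.Term (Fin 1)).definableFun_realize (M := K)
    simp only [Language.orderedRing.realize_neg, Term.realize_var] at h
    exact h
  have h2 : A.DefinableFun L' (fun w : Fin 1 → K => -w 0) :=
    definableFun_of_orderedRing φ h1.of_empty
  have hg : A.DefinableMap L' (fun v : ι → K => ![p v]) := by
    intro i
    fin_cases i
    simpa using hp
  simpa using h2.comp hg

/-- Finite sums of definable functions are definable. [folklore] -/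
theorem definableFun_sum {β : Type*} (T : Finset β) {F : β → (ι → K) → K}
    (h : ∀ b ∈ T, A.DefinableFun L' (F b)) : A.DefinableFun L' (fun v => ∑ b ∈ T, F b v) := by
  classical
  induction T using Finset.induction_on with
  | empty => simpa using definableFun_zero (A := A) (ι := ι) φ
  | insert b T hb ih =>
    have := definableFun_add φ (h b (Finset.mem_insert_self b T))
      (ih fun b' hb' => h b' (Finset.mem_insert_of_mem hb'))
    simpa [Finset.sum_insert hb] using this

/-- Finite products of definable functions are definable. [folklore] -/
theorem definableFun_prod {β : Type*} (T : Finset β) {F : β → (ι → K) → K}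
    (h : ∀ b ∈ T, A.DefinableFun L' (F b)) : A.DefinableFun L' (fun v => ∏ b ∈ T, F b v) := by
  classical
  induction T using Finset.induction_on with
  | empty => simpa using definableFun_one (A := A) (ι := ι) φ
  | insert b T hb ih =>
    have := definableFun_mul φ (h b (Finset.mem_insert_self b T))
      (ih fun b' hb' => h b' (Finset.mem_insert_of_mem hb'))
    simpa [Finset.prod_insert hb] using this

/-- **Determinants of matrices of definable functions are definable functions.** [folklore] -/
theorem definableFun_det {m : Type} [Fintype m] [DecidableEq m] {Mf : m → m → (ι → K) → K}
    (hM : ∀ i j, A.DefinableFun L' (Mf i j)) :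
    A.DefinableFun L' (fun v => (Matrix.of fun i j => Mf i j v).det) := by
  simp only [Matrix.det_apply', Matrix.of_apply]
  refine definableFun_sum φ _ fun σ _ => definableFun_mul φ ?_ (definableFun_prod φ _ fun i _ => hM _ _)
  rcases Int.units_eq_one_or (Equiv.Perm.sign σ) with hσ | hσ
  · simpa [hσ] using definableFun_one (A := A) (ι := ι) φ
  · simpa [hσ] using definableFun_neg φ (definableFun_one (A := A) (ι := ι) φ)

/-- `(1 + x²)⁻¹` applied to a definable function is definable: its graph is the algebraic set
`y (1 + x²) = 1`. [folklore] -/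
theorem definableFun_inv_one_add_sq {p : (ι → K) → K} (hp : A.DefinableFun L' p) :
    A.DefinableFun L' (fun v => (1 + p v ^ 2)⁻¹) := by
  have hG : A.Definable L' {w : Fin 2 → K | w 1 = (1 + w 0 ^ 2)⁻¹} := by
    have h1 : A.DefinableFun L' (fun w : Fin 2 → K => w 1 * (1 + w 0 * w 0)) :=
      definableFun_mul φ (Set.DefinableFun.proj L')
        (definableFun_add φ (definableFun_one φ)
          (definableFun_mul φ (Set.DefinableFun.proj L') (Set.DefinableFun.proj L')))
    have h2 := h1.setOf_eq (definableFun_one (A := A) (ι := Fin 2) φ)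
    convert h2 using 1
    ext w
    simp only [Set.mem_setOf_eq]
    have hpos : (1 + w 0 ^ 2) ≠ 0 := by positivity
    constructor
    · intro hw
      rw [hw, ← pow_two, inv_mul_cancel₀ hpos]
    · intro hw
      rw [← pow_two] at hw
      exact eq_inv_of_mul_eq_one_left hw
  exact definableFun_apply_params (f := fun x : K => (1 + x ^ 2)⁻¹) hG hp

omit φ in
/-- `e(x) = exp((1 + x²)⁻¹)` applied to a definable function is definable, when the graph of `e`
is `∅`-definable in `L'`. [folklore] -/
theorem definableFun_e (hE : (∅ : Set K).Definable L' {v : Fin 2 → K | v 1 = exp ((1 + v 0 ^ 2)⁻¹)})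
    {p : (ι → K) → K} (hp : A.DefinableFun L' p) :
    A.DefinableFun L' (fun v => exp ((1 + p v ^ 2)⁻¹)) :=
  definableFun_apply_params (f := fun x : K => exp ((1 + x ^ 2)⁻¹)) (hE.mono (Set.empty_subset A)) hp

/-- The graph of `x ↦ (1 + x²)⁻¹` is definable (the algebraic set `y (1 + x²) = 1`). [folklore] -/
theorem definable_graph_inv_one_add_sq : A.Definable L' {w : Fin 2 → K | w 1 = (1 + w 0 ^ 2)⁻¹} := by
  have h1 : A.DefinableFun L' (fun w : Fin 2 → K => w 1 * (1 + w 0 * w 0)) :=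
    definableFun_mul φ (Set.DefinableFun.proj L')
      (definableFun_add φ (definableFun_one φ)
        (definableFun_mul φ (Set.DefinableFun.proj L') (Set.DefinableFun.proj L')))
  have h2 := h1.setOf_eq (definableFun_one (A := A) (ι := Fin 2) φ)
  convert h2 using 1
  ext w
  simp only [Set.mem_setOf_eq]
  have hpos : (1 + w 0 ^ 2) ≠ 0 := by positivity
  constructor
  · intro hw
    rw [hw, ← pow_two, inv_mul_cancel₀ hpos]
  · intro hw
    rw [← pow_two] at hw
    exact eq_inv_of_mul_eq_one_left hw

variable {n : ℕ} {f : k ↪[Language.orderedExpRing] K} {s : Finset (Fin n)} {σ : Fin n → Fin n ⊕ Fin n}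
  {α : Fin n → K}

/-- **The specialised polynomials define `L'`-definable functions** of the new unknowns, over any
parameter set containing `f(k)`, the values `αⱼ, (1 + αⱼ²)⁻¹, e(αⱼ)` for the unselected unknowns
`xⱼ` and `exp αⱼ` for the unselected symbols `yⱼ` with `j ∈ s` — for polynomials from `Mˢₙ`
(induction over the generators `xⱼ, uⱼ, vⱼ (j ≤ n)`, `yⱼ (j ∈ s)`: a selected generator
evaluates to a coordinate, to `(1 + β²)⁻¹` or to `e(β)` of a coordinate, an unselected one to a
parameter). [cite: DenBesten2016, proof of Lemma 7.2.4 (Claim)] -/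
theorem definableFun_msEval_specialise (hσ : Function.Injective σ)
    (hE : (∅ : Set K).Definable L' {v : Fin 2 → K | v 1 = exp ((1 + v 0 ^ 2)⁻¹)})
    (hf : Set.range f ⊆ A)
    (hx : ∀ j, (∀ j₁, σ j₁ ≠ Sum.inl j) → α j ∈ A ∧ (1 + α j ^ 2)⁻¹ ∈ A ∧ exp ((1 + α j ^ 2)⁻¹) ∈ A)
    (hy : ∀ j ∈ s, (∀ j₁, σ j₁ ≠ Sum.inr j) → exp (α j) ∈ A)
    {Q : MvPolynomial (MsVar n) k} (hQ : MsSupported s Q) :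
    A.DefinableFun L' (fun β : Fin n → K =>
      msEval (Embedding.refl Language.orderedExpRing K) β (specialise σ α f Q)) := by
  classical
  rw [msSupported_iff_mem_supported, supported_eq_adjoin_X] at hQ
  -- the generators
  have hgen : ∀ w : MsVar n, (w.1 = MsKind.y → w.2 ∈ s) → A.DefinableFun L' (fun β : Fin n → K =>
      msEval (Embedding.refl Language.orderedExpRing K) β (selSubst σ α w)) := by
    rintro ⟨κ, j₀⟩ hw
    cases κ
    · show A.DefinableFun L' fun β => msEval _ β (selGen σ (Sum.inl j₀) (fun j₁ => (MsKind.x, j₁)) (α j₀))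
      by_cases hc : ∃ j₁, σ j₁ = Sum.inl j₀
      · obtain ⟨j₁, hj₁⟩ := hc
        simpa [selGen_of_eq hσ hj₁] using (Set.DefinableFun.proj L' (A := A) (i := j₁))
      · push Not at hc
        simpa [selGen_of_forall_ne hc] using
          FirstOrder.Language.definableFun_const L' (Fin n) (hx j₀ hc).1
    · show A.DefinableFun L' fun β => msEval _ β (selGen σ (Sum.inl j₀) (fun j₁ => (MsKind.u, j₁)) _)
      by_cases hc : ∃ j₁, σ j₁ = Sum.inl j₀
      · obtain ⟨j₁, hj₁⟩ := hc
        simpa [selGen_of_eq hσ hj₁] using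
          definableFun_inv_one_add_sq φ (Set.DefinableFun.proj L' (A := A) (i := j₁))
      · push Not at hc
        simpa [selGen_of_forall_ne hc] using
          FirstOrder.Language.definableFun_const L' (Fin n) (hx j₀ hc).2.1
    · show A.DefinableFun L' fun β => msEval _ β (selGen σ (Sum.inl j₀) (fun j₁ => (MsKind.v, j₁)) _)
      by_cases hc : ∃ j₁, σ j₁ = Sum.inl j₀
      · obtain ⟨j₁, hj₁⟩ := hc
        simpa [selGen_of_eq hσ hj₁] using
          definableFun_e hE (Set.DefinableFun.proj L' (A := A) (i := j₁))
      · push Not at hc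
        simpa [selGen_of_forall_ne hc] using
          FirstOrder.Language.definableFun_const L' (Fin n) (hx j₀ hc).2.2
    · show A.DefinableFun L' fun β => msEval _ β (selGen σ (Sum.inr j₀) (fun j₁ => (MsKind.x, j₁)) _)
      by_cases hc : ∃ j₁, σ j₁ = Sum.inr j₀
      · obtain ⟨j₁, hj₁⟩ := hc
        simpa [selGen_of_eq hσ hj₁] using (Set.DefinableFun.proj L' (A := A) (i := j₁))
      · push Not at hc
        simpa [selGen_of_forall_ne hc] using
          FirstOrder.Language.definableFun_const L' (Fin n) (hy j₀ (hw rfl) hc)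
  induction hQ using Algebra.adjoin_induction with
  | mem x hx' =>
    obtain ⟨w, hw, rfl⟩ := hx'
    simpa using hgen w hw
  | algebraMap r =>
    simpa [MvPolynomial.algebraMap_eq] using
      FirstOrder.Language.definableFun_const L' (Fin n) (hf ⟨r, rfl⟩)
  | add x y _ _ hx' hy' => simpa [_root_.map_add] using definableFun_add φ hx' hy'
  | mul x y _ _ hx' hy' => simpa [_root_.map_mul] using definableFun_mul φ hx' hy'

variable {P : Fin n → MvPolynomial (MsVar n) k}

/-- **The non-singular zeros of the specialised system form an `L'`-definable set** over the same
parameters (den Besten: "the `hᵢ` are `k'`-definable over `α_{n+1}, …, α_{n+m}`"): the values of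
the `hᵢ` and the entries of their Jacobian (`RealExpModel.msD_specialise`: specialised
derivatives of the `Pᵢ`, again in `Mˢₙ`) are definable functions, and so is a determinant of
definable functions. [cite: DenBesten2016, proof of Lemma 7.2.4 (Claim)] -/
theorem definable_setOf_isMsZero_specialise (hP : ∀ i, MsSupported s (P i)) (hσ : Function.Injective σ)
    (hE : (∅ : Set K).Definable L' {v : Fin 2 → K | v 1 = exp ((1 + v 0 ^ 2)⁻¹)})
    (hf : Set.range f ⊆ A)
    (hx : ∀ j, (∀ j₁, σ j₁ ≠ Sum.inl j) → α j ∈ A ∧ (1 + α j ^ 2)⁻¹ ∈ A ∧ exp ((1 + α j ^ 2)⁻¹) ∈ A)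
    (hy : ∀ j ∈ s, (∀ j₁, σ j₁ ≠ Sum.inr j) → exp (α j) ∈ A) :
    A.Definable L' {β : Fin n → K |
      IsMsZero (Embedding.refl Language.orderedExpRing K) ∅ (fun i => specialise σ α f (P i)) β} := by
  classical
  have hval : ∀ i, A.DefinableFun L' (fun β : Fin n → K =>
      msEval (Embedding.refl Language.orderedExpRing K) β (specialise σ α f (P i))) := fun i =>
    definableFun_msEval_specialise φ hσ hE hf hx hy (hP i)
  have hjac : ∀ i j, A.DefinableFun L' (fun β : Fin n → K =>
      msEval (Embedding.refl Language.orderedExpRing K) β (msD K j (specialise σ α f (P i)))) := by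
    intro i j
    simpa only [msD_specialise hσ] using
      definableFun_msEval_specialise φ hσ hE hf hx hy (msSupported_colDeriv s (hP i) (σ j))
  have hS : {β : Fin n → K |
      IsMsZero (Embedding.refl Language.orderedExpRing K) ∅ (fun i => specialise σ α f (P i)) β} =
      (⋂ i, {β | msEval (Embedding.refl Language.orderedExpRing K) β (specialise σ α f (P i)) = 0}) ∩
        {β | (Matrix.of fun i j => msEval (Embedding.refl Language.orderedExpRing K) β
          (msD K j (specialise σ α f (P i)))).det = 0}ᶜ := by
    ext β
    simp only [IsMsZero, Set.mem_setOf_eq, Set.mem_inter_iff, Set.mem_iInter, Set.mem_compl_iff]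
    exact ⟨fun h => ⟨h.2.1, h.2.2⟩, fun h => ⟨fun i => msSupported_empty_specialise (P i), h.1, h.2⟩⟩
  rw [hS]
  refine (Set.definable_iInter_of_finite fun i => (hval i).setOf_eq (definableFun_zero φ)).inter ?_
  exact ((definableFun_det φ hjac).setOf_eq (definableFun_zero φ)).compl

omit φ in
/-- **The coordinates of the points of a finite `A`-definable subset of `Kᴺ` lie in `dcl(A)`**
(project to each coordinate: a finite `A`-definable subset of the line, whose points are
`A`-definable, `subset_definableClosure_of_finite`). [cite: DenBesten2016, Lemma 7.1.6 (iv)] -/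
theorem apply_mem_definableClosure_of_finite {N : ℕ} {S : Set (Fin N → K)} (hS : A.Definable L' S)
    (hfin : S.Finite) (hlt : A.Definable L' {v : Fin 2 → K | v 0 < v 1}) {w : Fin N → K} (hw : w ∈ S)
    (l : Fin N) : w l ∈ definableClosure L' A := by
  have hT : A.Definable₁ L' ((fun w : Fin N → K => w l) '' S) := by
    have h := hS.image_comp (fun _ : Fin 1 => l)
    rw [Set.Definable₁]
    convert h using 1
    ext v
    simp only [Set.mem_setOf_eq, Set.mem_image]
    constructor
    · rintro ⟨w', hw', hv⟩
      exact ⟨w', hw', funext fun i => by rw [Subsingleton.elim i 0]; simpa using hv⟩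
    · rintro ⟨w', hw', hv⟩
      exact ⟨w', hw', by simpa using congrFun hv 0⟩
  exact subset_definableClosure_of_finite hlt hT (hfin.image _) (Set.mem_image_of_mem _ hw)

end Definability

/-! ### `dcl` in an expansion of the ordered field is a subring -/

section Subring

variable {L' : FirstOrder.Language.{0, 0}} [L'.Structure K] (φ : Language.orderedRing →ᴸ L') [φ.IsExpansionOn K]
variable {A : Set K}

include φ

/-- `dcl(A)` is closed under `+` (it is a substructure, and `+` is a symbol of the expanded
language). [folklore] -/
theorem add_mem_definableClosure {a b : K} (ha : a ∈ definableClosure L' A)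
    (hb : b ∈ definableClosure L' A) : a + b ∈ definableClosure L' A := by
  have h := (definableClosureSubstructure L' A).fun_mem (φ.onFunction ringFunc.add) ![a, b] (by
    intro i
    fin_cases i
    · simpa [mem_definableClosureSubstructure] using ha
    · simpa [mem_definableClosureSubstructure] using hb)
  rw [LHom.IsExpansionOn.map_onFunction, Language.orderedRing.funMap_add] at h
  simpa [mem_definableClosureSubstructure] using h

/-- `dcl(A)` is closed under `·`. [folklore] -/
theorem mul_mem_definableClosure {a b : K} (ha : a ∈ definableClosure L' A)
    (hb : b ∈ definableClosure L' A) : a * b ∈ definableClosure L' A := by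
  have h := (definableClosureSubstructure L' A).fun_mem (φ.onFunction ringFunc.mul) ![a, b] (by
    intro i
    fin_cases i
    · simpa [mem_definableClosureSubstructure] using ha
    · simpa [mem_definableClosureSubstructure] using hb)
  rw [LHom.IsExpansionOn.map_onFunction, Language.orderedRing.funMap_mul] at h
  simpa [mem_definableClosureSubstructure] using h

/-- `dcl(A)` is closed under `-`. [folklore] -/
theorem neg_mem_definableClosure {a : K} (ha : a ∈ definableClosure L' A) :
    -a ∈ definableClosure L' A := by
  have h := (definableClosureSubstructure L' A).fun_mem (φ.onFunction ringFunc.neg) ![a] (by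
    intro i
    fin_cases i
    simpa [mem_definableClosureSubstructure] using ha)
  rw [LHom.IsExpansionOn.map_onFunction, Language.orderedRing.funMap_neg] at h
  simpa [mem_definableClosureSubstructure] using h

/-- `1 ∈ dcl(A)`. [folklore] -/
theorem one_mem_definableClosure : (1 : K) ∈ definableClosure L' A := by
  have h := (definableClosureSubstructure L' A).fun_mem (φ.onFunction ringFunc.one) ![]
    (fun i => Fin.elim0 i)
  rw [LHom.IsExpansionOn.map_onFunction, Language.orderedRing.funMap_one] at h
  simpa [mem_definableClosureSubstructure] using h

/-- `0 ∈ dcl(A)`. [folklore] -/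
theorem zero_mem_definableClosure' : (0 : K) ∈ definableClosure L' A := by
  have h := (definableClosureSubstructure L' A).fun_mem (φ.onFunction ringFunc.zero) ![]
    (fun i => Fin.elim0 i)
  rw [LHom.IsExpansionOn.map_onFunction, Language.orderedRing.funMap_zero] at h
  simpa [mem_definableClosureSubstructure] using h

/-- Integers lie in `dcl(A)`. [folklore] -/
theorem intCast_mem_definableClosure (ν : ℤ) : (ν : K) ∈ definableClosure L' A := by
  have hnat : ∀ m : ℕ, (m : K) ∈ definableClosure L' A := by
    intro m
    induction m with
    | zero => simpa using zero_mem_definableClosure' (A := A) φ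
    | succ m ih =>
      simpa [Nat.cast_succ] using add_mem_definableClosure φ ih (one_mem_definableClosure φ)
  obtain ⟨m, rfl | rfl⟩ := Int.eq_nat_or_neg ν
  · simpa using hnat m
  · simpa using neg_mem_definableClosure φ (hnat m)

/-- **Integer linear combinations of elements of `dcl(A)` lie in `dcl(A)`** — in particular
the elements `z = Σ νᵢ αᵢ` of 9.3 lie in den Besten's `k*`. [folklore] -/
theorem sum_intCast_mul_mem_definableClosure {m : ℕ} {α : Fin m → K}
    (hα : ∀ j, α j ∈ definableClosure L' A) (ν : Fin m → ℤ) :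
    ∑ i, (ν i : K) * α i ∈ definableClosure L' A := by
  refine Finset.sum_induction _ (fun x => x ∈ definableClosure L' A)
    (fun a b ha hb => add_mem_definableClosure φ ha hb) (zero_mem_definableClosure' φ) ?_
  intro i _
  exact mul_mem_definableClosure φ (intCast_mem_definableClosure φ (ν i)) (hα i)

end Subring

end DclClaim

/-! ### The Claim -/

open DclClaim in
/-- **Wilkie 1996, §11 / den Besten 2016, Lemma 7.2.4, Claim (`dim_{k'} k* ≤ m`), definability
form.** Let `k ⊆ K` be models of `T_exp` (embedding `f`), `ᾱ ∈ Kⁿ` a non-singular zero of a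
square system `P₁, …, Pₙ` from `Mˢₙ` over `k`, and let `L'` be any language on `K` expanding
`(+, ·, -, 0, 1, ≤)` compatibly in which the graph of `e(x) = exp((1 + x²)⁻¹)` is definable
without parameters (e.g. `L_e`, `RealExpModel.IsMsZero.exists_kstar_orderedERing`).  Then there
is a set `B` of at most `|s|` of the values `αⱼ (j ≤ n)`, `exp αⱼ (j ∈ s)` such that all of
`α₁, …, αₙ` and `exp αⱼ (j ∈ s)` are `L'`-definable over `f(k) ∪ B` — den Besten: "Since the `hᵢ`
are `k'`-definable over `α_{n+1}, …, α_{n+m}`, this implies that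
`α₁, …, αₙ ∈ Dcl_{k'}({αᵢ | n + 1 ≤ i ≤ n + m})`" (after the relabelling putting the `n`
selected generators first).  Proof as printed, on top of `Wilkie1996JacobianColumns.lean`
(`RealExpModel.IsMsZero.exists_selection`: the selected values form a non-singular zero of the
specialised square system `h̄ ∈ M^∅ₙ` over `K`, one of finitely many by Proposition 9.2 (iii)):
`B` is the set of values of the `|s|` unselected generators (`card_unselected`), the set of
non-singular zeros of `h̄` is `L'`-definable over `f(k) ∪ B` (`definable_setOf_isMsZero_specialise`,
the auxiliary parameters `(1 + αⱼ²)⁻¹`, `e(αⱼ)` being definable over `αⱼ`), and the coordinates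
of the points of a finite definable set lie in the definable closure
(`apply_mem_definableClosure_of_finite`). [cite: DenBesten2016, Lemma 7.2.4 (Claim)]
[cite: WilkieJAMS1996, §11] -/
theorem IsMsZero.exists_subset_definableClosure {f : k ↪[Language.orderedExpRing] K} {n : ℕ}
    {s : Finset (Fin n)} {P : Fin n → MvPolynomial (MsVar n) k} {α : Fin n → K}
    (h : IsMsZero f s P α) {L' : FirstOrder.Language.{0, 0}} [L'.Structure K]
    (φ : Language.orderedRing →ᴸ L') [φ.IsExpansionOn K]
    (hE : (∅ : Set K).Definable L' {v : Fin 2 → K | v 1 = exp ((1 + v 0 ^ 2)⁻¹)}) :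
    ∃ B : Finset K, B.card ≤ s.card ∧
      (↑B ⊆ Set.range α ∪ Set.range (fun j : s => exp (α j))) ∧
      (∀ j, α j ∈ definableClosure L' (Set.range f ∪ ↑B)) ∧
      (∀ j ∈ s, exp (α j) ∈ definableClosure L' (Set.range f ∪ ↑B)) := by
  classical
  obtain ⟨σ, hσ, hσs, hZ, hfin⟩ := h.exists_selection
  -- the unselected generators and their values
  set U : Finset (Fin n ⊕ Fin n) := (Finset.univ.image σ)ᶜ \ sᶜ.image Sum.inr with hU
  set B : Finset K := U.image (colVal α) with hB
  have hUx : ∀ j, (∀ j₁, σ j₁ ≠ Sum.inl j) → α j ∈ B := fun j hj => by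
    rw [hB, Finset.mem_image]
    exact ⟨Sum.inl j, mem_unselected_iff.2 ⟨hj, fun i hi => by cases hi⟩, rfl⟩
  have hUy : ∀ i ∈ s, (∀ j₁, σ j₁ ≠ Sum.inr i) → exp (α i) ∈ B := fun i his hi => by
    rw [hB, Finset.mem_image]
    exact ⟨Sum.inr i, mem_unselected_iff.2 ⟨hi, fun i' hi' => by cases hi'; exact his⟩, rfl⟩
  refine ⟨B, ?_, ?_, ?_⟩
  · calc B.card ≤ U.card := Finset.card_image_le
      _ = s.card := card_unselected hσ hσs
  · intro b hb
    rw [hB, Finset.coe_image, Set.mem_image] at hb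
    obtain ⟨c, hc, rfl⟩ := hb
    have hc' := mem_unselected_iff.1 (Finset.mem_coe.1 hc)
    rcases c with j | i
    · exact Or.inl ⟨j, rfl⟩
    · exact Or.inr ⟨⟨i, hc'.2 i rfl⟩, rfl⟩
  -- definability over the definable closure `D` of `A = f(k) ∪ B`
  set A : Set K := Set.range f ∪ ↑B with hA
  have hBA : ∀ b ∈ B, b ∈ definableClosure L' A := fun b hb =>
    subset_definableClosure _ (Or.inr (Finset.mem_coe.2 hb))
  have hfD : Set.range f ⊆ definableClosure L' A := fun x hx => subset_definableClosure _ (Or.inl hx)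
  have hxD : ∀ j, (∀ j₁, σ j₁ ≠ Sum.inl j) → α j ∈ definableClosure L' A ∧
      (1 + α j ^ 2)⁻¹ ∈ definableClosure L' A ∧ exp ((1 + α j ^ 2)⁻¹) ∈ definableClosure L' A := by
    intro j hj
    have hαj : α j ∈ definableClosure L' A := hBA _ (hUx j hj)
    exact ⟨hαj, apply_mem_definableClosure (f := fun x : K => (1 + x ^ 2)⁻¹)
        (definable_graph_inv_one_add_sq φ) hαj,
      apply_mem_definableClosure (f := fun x : K => exp ((1 + x ^ 2)⁻¹))
        (hE.mono (Set.empty_subset _)) hαj⟩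
  have hyD : ∀ i ∈ s, (∀ j₁, σ j₁ ≠ Sum.inr i) → exp (α i) ∈ definableClosure L' A :=
    fun i his hi => hBA _ (hUy i his hi)
  have hS : A.Definable L' {β : Fin n → K |
      IsMsZero (Embedding.refl Language.orderedExpRing K) ∅ (fun i => specialise σ α f (P i)) β} :=
    (definable_setOf_isMsZero_specialise φ h.1 hσ hE hfD hxD hyD).of_subset_definableClosure le_rfl
  have hlt : A.Definable L' {v : Fin 2 → K | v 0 < v 1} :=
    (definable_lt_empty_of_expansion φ).mono (Set.empty_subset A)
  have hsel : ∀ j₁, colVal α (σ j₁) ∈ definableClosure L' A := fun j₁ =>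
    apply_mem_definableClosure_of_finite hS hfin hlt hZ j₁
  refine ⟨fun j => ?_, fun i hi => ?_⟩
  · by_cases hc : ∃ j₁, σ j₁ = Sum.inl j
    · obtain ⟨j₁, hj₁⟩ := hc
      simpa [hj₁] using hsel j₁
    · push Not at hc
      exact hBA _ (hUx j hc)
  · by_cases hc : ∃ j₁, σ j₁ = Sum.inr i
    · obtain ⟨j₁, hj₁⟩ := hc
      simpa [hj₁] using hsel j₁
    · push Not at hc
      exact hBA _ (hUy i hi hc)

open DclClaim in
/-- **The Claim as an equality of definable closures**: `Dcl(f(k) ∪ {ᾱ} ∪ {exp αⱼ : j ∈ s})`,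
den Besten's `k*` computed in `L'`, equals `Dcl(f(k) ∪ B)` for a set `B` of at most `|s|` of these
values — "we will show that `{αᵢ | 1 ≤ i ≤ n + m}` contains an `m`-element subset which
generates `k*` over `k'`", whence `dim_{k'}(k*) ≤ m` for the dimension function of any
pregeometry extending `Dcl` (`OMinimalPregeometry.lean`). [cite: DenBesten2016, Lemma 7.2.4 (Claim)] -/
theorem IsMsZero.exists_definableClosure_eq {f : k ↪[Language.orderedExpRing] K} {n : ℕ}
    {s : Finset (Fin n)} {P : Fin n → MvPolynomial (MsVar n) k} {α : Fin n → K}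
    (h : IsMsZero f s P α) {L' : FirstOrder.Language.{0, 0}} [L'.Structure K]
    (φ : Language.orderedRing →ᴸ L') [φ.IsExpansionOn K]
    (hE : (∅ : Set K).Definable L' {v : Fin 2 → K | v 1 = exp ((1 + v 0 ^ 2)⁻¹)}) :
    ∃ B : Finset K, B.card ≤ s.card ∧
      (↑B ⊆ Set.range α ∪ Set.range (fun j : s => exp (α j))) ∧
      definableClosure L' (Set.range f ∪ (Set.range α ∪ Set.range (fun j : s => exp (α j)))) =
        definableClosure L' (Set.range f ∪ ↑B) := by
  obtain ⟨B, hB, hBsub, hα, hexp⟩ := h.exists_subset_definableClosure φ hE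
  refine ⟨B, hB, hBsub, Set.Subset.antisymm ?_ ?_⟩
  · refine definableClosure_subset_of_subset ?_
    rintro x (hx | hx | hx)
    · exact subset_definableClosure _ (Or.inl hx)
    · obtain ⟨j, rfl⟩ := hx
      exact hα j
    · obtain ⟨j, rfl⟩ := hx
      exact hexp j j.2
  · exact definableClosure_mono (Set.union_subset_union_right _ hBsub)

open DclClaim in
/-- **The Claim in the form consumed by 9.3** (`RealExpModel.lemma93_of_valuationInequality`,
`Wilkie1996ValuationStep.lean`; `Wilkie1996Lemma93Valuation.lean`): there is a set `B` of at
most `|s|` of the values `αⱼ`, `exp αⱼ (j ∈ s)` such that `k* := Dcl_{L'}(f(k) ∪ B)` contains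
every `z = Σ νᵢ αᵢ` (`νᵢ ∈ ℤ`), every `αⱼ`, and every `exp αⱼ`, `j ∈ s` — so that, once the
valuation inequality `valdim ≤ dim` for the theory of `K` in `L'` (Wilkie 1996, Theorems
10.3–10.4; den Besten, Theorems 7.1.21–7.1.23) bounds the valuative rank of `k*` over `f(k)` by
`|B| ≤ |s|`, any `|s| + 1` of these elements are multiplicatively dependent modulo `f(k)^×` and
the units, which is the hypothesis `hval` of
`Wilkie1996_expPolynomialPoints_bounded_of_valuationInequality`.
[cite: DenBesten2016, Lemma 7.2.4 (Claim) and proof of (36)] [cite: WilkieJAMS1996, §11] -/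
theorem IsMsZero.exists_kstar {f : k ↪[Language.orderedExpRing] K} {n : ℕ}
    {s : Finset (Fin n)} {P : Fin n → MvPolynomial (MsVar n) k} {α : Fin n → K}
    (h : IsMsZero f s P α) {L' : FirstOrder.Language.{0, 0}} [L'.Structure K]
    (φ : Language.orderedRing →ᴸ L') [φ.IsExpansionOn K]
    (hE : (∅ : Set K).Definable L' {v : Fin 2 → K | v 1 = exp ((1 + v 0 ^ 2)⁻¹)}) :
    ∃ B : Finset K, B.card ≤ s.card ∧
      (↑B ⊆ Set.range α ∪ Set.range (fun j : s => exp (α j))) ∧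
      (∀ ν : Fin n → ℤ, ∑ i, (ν i : K) * α i ∈ definableClosure L' (Set.range f ∪ ↑B)) ∧
      (∀ j, α j ∈ definableClosure L' (Set.range f ∪ ↑B)) ∧
      (∀ j ∈ s, exp (α j) ∈ definableClosure L' (Set.range f ∪ ↑B)) := by
  obtain ⟨B, hB, hBsub, hα, hexp⟩ := h.exists_subset_definableClosure φ hE
  exact ⟨B, hB, hBsub, fun ν => sum_intCast_mul_mem_definableClosure φ hα ν, hα, hexp⟩

/-! ### The Claim in the language `L_e` of `T_e` -/

/-- The graph of `e(x) = exp((1 + x²)⁻¹)` is definable without parameters in `L_e` on a model of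
`T_exp` (it is the graph of the function symbol `e`, `RealExpModel.e_def`). [cite: DenBesten2016, Definition 6.2.2] -/
theorem definable_eGraph_orderedERing (K : Language.Theory.ModelType.{0, 0, 0} realExpTheory) :
    (∅ : Set K).Definable Language.orderedERing {v : Fin 2 → K | v 1 = exp ((1 + v 0 ^ 2)⁻¹)} := by
  rw [Set.empty_definable_iff]
  refine ⟨(Term.var 1).equal (Term.func (Sum.inr eFunc.e : Language.orderedERing.Functions 1)
    ![Term.var 0]), ?_⟩
  ext v
  simp only [Set.mem_setOf_eq, Formula.realize_equal, Term.realize_var, Term.realize_func]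
  rfl

open DclClaim in
/-- **den Besten 2016, Lemma 7.2.4, Claim, in `L_e`**: for models `k ⊆ K` of `T_exp` and a
non-singular zero `ᾱ ∈ Kⁿ` of a square system from `Mˢₙ` over `k`, there is a set `B` of at most
`|s|` of the values `αⱼ`, `exp αⱼ (j ∈ s)` such that `k* = Dcl_e(f(k) ∪ B)` — the definable
closure in the `e`-reduct `K | L_e ⊨ T_e` (`ETheory.lean`) — contains all `Σ νᵢ αᵢ` (`νᵢ ∈ ℤ`),
all `αⱼ` and all `exp αⱼ (j ∈ s)`; in particular `dim_{k'} k* ≤ |s|` for the `Dcl_e`-dimension.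
This is the entrance of the valuation inequality for `T_e` into the proof of 9.3.
[cite: DenBesten2016, Lemma 7.2.4 (Claim)] [cite: WilkieJAMS1996, §11] -/
theorem IsMsZero.exists_kstar_orderedERing {f : k ↪[Language.orderedExpRing] K} {n : ℕ}
    {s : Finset (Fin n)} {P : Fin n → MvPolynomial (MsVar n) k} {α : Fin n → K}
    (h : IsMsZero f s P α) :
    ∃ B : Finset K, B.card ≤ s.card ∧
      (↑B ⊆ Set.range α ∪ Set.range (fun j : s => exp (α j))) ∧
      (∀ ν : Fin n → ℤ, ∑ i, (ν i : K) * α i ∈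
        definableClosure Language.orderedERing (Set.range f ∪ ↑B)) ∧
      (∀ j, α j ∈ definableClosure Language.orderedERing (Set.range f ∪ ↑B)) ∧
      (∀ j ∈ s, exp (α j) ∈ definableClosure Language.orderedERing (Set.range f ∪ ↑B)) :=
  h.exists_kstar (LHom.sumInl : Language.orderedRing →ᴸ Language.orderedERing)
    (definable_eGraph_orderedERing K)

end RealExpModel

end Literature.ModelTheory.ExponentialFields
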